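import Summits.SmoothPoincare4.SmoothPoincare4.Theorems.ConvexBisectionAcyclicBisectionExistsSeamTwistSignAmbient
import Summits.SmoothPoincare4.SmoothPoincare4.Theorems.ConvexBisectionAcyclicBisectionExistsStabTwistTransportAlgebra
import Literature.Geometry.Manifold.OpenSubmanifoldMFDeriv
import Literature.Topology.FourManifolds.HandleAttachingMapsAssoc
import HarnessLib

/-!
# N3 (`stub_STgeo`) ▸ N3-nat ▸ N3d-1 `node_stabBaseData` ▸ G1d: TRANSPORT OF PAGE TWISTINGS ACROSS
# GENERA by a fibred, page-orientation-preserving smooth map given through local ambient representatives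
(wave 8, brick J6-1 of stub `stub_STgeo` = node N3 of NF4, line `modp-braid-orbits`, crux
`ConvexBisection.AcyclicBisectionExists`, item stmt-SmoothPoincare4-10508; registered sub-goal
`helper_pageTwisting_localRep`; the clause `twisting_transport` of `StabBaseData`
(`…StabilisationData.lean`, H6-1) = part G1d of what remains of N3d-1 (`H6Remaining.RemainingN3d1`,
report H6 §5).)

The landed `pageTwisting_transport_eq_of_fibred` (p132432) transports page twistings along ambient
isotopies of ONE base; the 1-handle presentation `E.jA : Base g ∖ cores → Base (g+1)` of N3d-1 goes
ACROSS genera.  This file proves the cross-genera transport theorem in the form the E-constructor can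
feed: for an open submanifold `O ⊆ Base g`, a smooth embedding `Θ : O → Base g'`, a smoothly embedded
framed page curve `(K ⊂ page g d, ν)` inside `O` with `Θ ∘ K ⊂ page g' d`, such that near every point of
`K` (i) `Θ` is FIBRED (`w_{g'} ∘ Θ = w_g`), and (ii) `Θ` is, in `ℝ⁴`, the restriction of a `C¹` map
`J` whose Jacobian has POSITIVE PAGE DETERMINANT (`pageDet`, X3's page-orientation character), the pushed
framed curve `(Θ ∘ K, dΘ ν)` has the page twisting of `(K, ν)`:

* §1 `continuous_pageTwistingLoop_of_ambient` — continuity of a twisting loop from the continuity of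
  the AMBIENT framing vectors (no tangent-bundle topology of the open submanifold needed);
* §2 the chain rules through a local ambient representative `J`: velocity
  (`hasDerivAt_ambCurve_localRep`), framing vectors (`ambient_mfderiv_localRep`:
  `ambient' (dΘ v) = dJ (ambient v)`), and fibredness `dΦ' ∘ dJ = dΦ` on all of `ℝ⁴`
  (`dPhi_localRep_of_fibred`, differentiating `w' ∘ Θ = w` along the manifold with boundary);
* §3 `pageTwisting_localRep` — the pointwise frame relations (`inner_horizNormal_transport`, H6-8;
  `inner_cplxJ_map_of_mem_line`, `inner_cplxJ_map_eq_mul_pageDet`, X3) fed to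
  `wind_eq_of_pointwise_frame` with `s₀ = 1`;
* §4 `twisting_transport_of_localRep` — the clause `twisting_transport` of `StabBaseData g n c` VERBATIM
  for any `E : MultiAttachmentData q1 (𝓡∂ 4) (Base (g+1))` from `flat`, fibredness NEAR the points off
  the 1-handle ranges, and local representatives with positive page determinant at flat page points;
  registered ∀-form `helper_pageTwisting_localRep`.

Everything is proved; no definitions, no named facts.  References: J. B. Etnyre, T. Fuller, IMRN 2006,
§2 and Thm. 1 (proof, p. 8) [EtnyreFuller2006]; J. M. Lee, *Introduction to Smooth Manifolds* (2013),
Prop. 3.9 [LeeSmoothManifolds2013].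
-/

noncomputable section

-- the prescribed namespace `Summit.<P>.<Sub>.…` duplicates `SmoothPoincare4` (P = Sub)
set_option linter.dupNamespace false

open scoped Manifold ContDiff Topology ComplexConjugate
open Set Function Metric Filter
open Literature.Topology.FourManifolds Literature.Topology.FourManifolds.LefschetzBase
open Literature.Topology.FourManifolds.HandleAttachingMap
open Literature.Geometry.Symplectic Literature.Geometry.Manifold

namespace Summit.SmoothPoincare4.SmoothPoincare4.Theorems.AcyclicBisectionExists.ModpBraidOrbits

namespace StabTwistTransport

variable {g g' : ℕ}

/-! ## §1 Continuity of a twisting loop from ambient data -/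

/-- The ambient unit-period parametrisation of a `C¹` loop is `C¹`. [folklore] -/
theorem contDiff_ambCurve_of_contMDiff {K : sphere (0 : EuclideanSpace ℝ (Fin 2)) 1 → Base g}
    (hK : ContMDiff (𝓡 1) (𝓡∂ 4) 1 K) : ContDiff ℝ 1 (ambCurve g K) := by
  have h : ContMDiff 𝓘(ℝ, ℝ) (𝓡 4) 1 (ambCurve g K) :=
    ((RegularSublevel.contMDiff_incl (isRegularLevel_rho g)).of_le (by simp)).comp
      (hK.comp (contMDiff_circlePt.of_le (by simp)))
  exact contMDiff_iff_contDiff.1 h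

/-- **The twisting loop of a `C¹` loop with a framing whose AMBIENT vectors `ambient g (K θ) (ν θ)`
depend continuously on `θ` is continuous.** [folklore] -/
theorem continuous_pageTwistingLoop_of_ambient {K : sphere (0 : EuclideanSpace ℝ (Fin 2)) 1 → Base g}
    {ν : sphere (0 : EuclideanSpace ℝ (Fin 2)) 1 → EuclideanSpace ℝ (Fin 4)}
    (hK : ContMDiff (𝓡 1) (𝓡∂ 4) 1 K) (hA : Continuous fun θ => ambient g (K θ) (ν θ)) :
    Continuous (pageTwistingLoop g K ν) := by
  have hfam := continuousOn_pageTwistingLoop_family (g := g) (K := fun _ => K) (ν := fun _ => ν)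
    (hK.continuous.comp continuous_snd).continuousOn
    ((hA.comp (continuous_circlePt.comp continuous_snd)).continuousOn)
    (continuousOn_deriv_of_contDiff_family (K := fun _ => K)
      ((contDiff_ambCurve_of_contMDiff hK).comp contDiff_snd) _)
  exact hfam.comp_continuous (f := fun t : ℝ => ((0 : ℝ), t))
    (continuous_const.prodMk continuous_id) fun t => ⟨⟨le_rfl, zero_le_one⟩, mem_univ _⟩

/-! ## §2 Chain rules through a local ambient representative -/

section LocalRep

variable {O : TopologicalSpace.Opens (Base g)}

/-- The inclusion `O ⊆ Base g ⊆ ℝ⁴` of an open submanifold has differential `ambientCLM` (the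
inclusion of the open submanifold has identity differential). [cite: LeeSmoothManifolds2013, Prop. 3.9] -/
theorem hasMFDerivAt_coe_coe (a : O) :
    HasMFDerivAt (𝓡∂ 4) (𝓡 4) (fun b : O => ((b : Base g).1 : EuclideanSpace ℝ (Fin 4))) a
      ((ambientCLM g (a : Base g)).comp (ContinuousLinearMap.id ℝ (EuclideanSpace ℝ (Fin 4)))) :=
  (hasMFDerivAt_incl_base (a : Base g)).comp a (OpenSubmanifold.hasMFDerivAt_subtype_val a)

/-- **Framing vectors through a local ambient representative.**  If `Θ : O → Base g'` agrees near `a`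
with a map `J` of `ℝ⁴` (`(Θ b).1 = J b.1` near `a`), `J` differentiable at `a`, then for every chart
vector `v` at `a`: `ambient g' (Θ a) (dΘ_a v) = dJ_{a} (ambient g a v)` — the ambient differential of
`Θ` is the Jacobian of `J`. [cite: LeeSmoothManifolds2013, Prop. 3.9] -/
theorem ambient_mfderiv_localRep {Θ : O → Base g'} {a : O}
    {J : EuclideanSpace ℝ (Fin 4) → EuclideanSpace ℝ (Fin 4)}
    (hΘ : MDifferentiableAt (𝓡∂ 4) (𝓡∂ 4) Θ a) (hJ : DifferentiableAt ℝ J (a : Base g).1)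
    (hΘJ : ∀ᶠ b in 𝓝 a, (Θ b).1 = J (b : Base g).1) (v : EuclideanSpace ℝ (Fin 4)) :
    ambient g' (Θ a) (mfderiv (𝓡∂ 4) (𝓡∂ 4) Θ a v) = fderiv ℝ J (a : Base g).1 (ambient g (a : Base g) v) := by
  have h1 : HasMFDerivAt (𝓡∂ 4) (𝓡 4) (RegularSublevel.incl (isRegularLevel_rho g') ∘ Θ) a
      ((ambientCLM g' (Θ a)).comp (mfderiv (𝓡∂ 4) (𝓡∂ 4) Θ a)) :=
    (hasMFDerivAt_incl_base (Θ a)).comp a hΘ.hasMFDerivAt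
  have h2 : HasMFDerivAt (𝓡∂ 4) (𝓡 4)
      (J ∘ fun b : O => ((b : Base g).1 : EuclideanSpace ℝ (Fin 4))) a
      ((fderiv ℝ J (a : Base g).1).comp
        ((ambientCLM g (a : Base g)).comp (ContinuousLinearMap.id ℝ (EuclideanSpace ℝ (Fin 4))))) :=
    hJ.hasFDerivAt.hasMFDerivAt.comp a (hasMFDerivAt_coe_coe a)
  have heq : (RegularSublevel.incl (isRegularLevel_rho g') ∘ Θ) =ᶠ[𝓝 a]
      (J ∘ fun b : O => ((b : Base g).1 : EuclideanSpace ℝ (Fin 4))) := by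
    filter_upwards [hΘJ] with b hb
    exact hb
  have h3 := h2.congr_of_eventuallyEq heq
  have e := hasMFDerivAt_unique h1 h3
  have key : ambientCLM g' (Θ a) (mfderiv (𝓡∂ 4) (𝓡∂ 4) Θ a v) =
      fderiv ℝ J (a : Base g).1 (ambientCLM g (a : Base g) v) :=
    congrArg (fun L : EuclideanSpace ℝ (Fin 4) →L[ℝ] EuclideanSpace ℝ (Fin 4) => L v) e
  exact key

/-- **Fibredness differentiated**: if moreover `w_{g'} (Θ b) = w_g b` for `b` near `a`, then
`dΦ'_{Θ a} ∘ dJ_a = dΦ_a` on ALL of `ℝ⁴` (differentiate along the manifold with boundary `O`, whose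
ambient tangent space at `a` is `ℝ⁴`). [folklore] -/
theorem dPhi_localRep_of_fibred {Θ : O → Base g'} {a : O}
    {J : EuclideanSpace ℝ (Fin 4) → EuclideanSpace ℝ (Fin 4)}
    (hΘ : MDifferentiableAt (𝓡∂ 4) (𝓡∂ 4) Θ a) (hJ : DifferentiableAt ℝ J (a : Base g).1)
    (hΘJ : ∀ᶠ b in 𝓝 a, (Θ b).1 = J (b : Base g).1)
    (hfib : ∀ᶠ b in 𝓝 a, w g' (Θ b).1 = w g (b : Base g).1) (X : EuclideanSpace ℝ (Fin 4)) :
    dPhiX g' (Θ a).1 * cx (fderiv ℝ J (a : Base g).1 X) + dPhiY (Θ a).1 * cy (fderiv ℝ J (a : Base g).1 X) =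
      dPhiX g (a : Base g).1 * cx X + dPhiY (a : Base g).1 * cy X := by
  set v := (ambientEquiv g (a : Base g)).symm X with hv
  have hX : X = ambient g (a : Base g) v := (ambient_symm_apply (a : Base g) X).symm
  have hdw : ∀ (k : ℕ) (q : EuclideanSpace ℝ (Fin 4)), HasFDerivAt (w k) (fderiv ℝ (w k) q) q :=
    fun k q => (((contDiff_w k).differentiable (by simp)) q).hasFDerivAt
  -- `w' ∘ Θ` and `w ∘ val` differentiated along `O`
  have h1 : HasMFDerivAt (𝓡∂ 4) 𝓘(ℝ, ℂ)
      (w g' ∘ (RegularSublevel.incl (isRegularLevel_rho g') ∘ Θ)) a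
      ((fderiv ℝ (w g') (Θ a).1).comp ((ambientCLM g' (Θ a)).comp (mfderiv (𝓡∂ 4) (𝓡∂ 4) Θ a))) :=
    (hdw g' (Θ a).1).hasMFDerivAt.comp a ((hasMFDerivAt_incl_base (Θ a)).comp a hΘ.hasMFDerivAt)
  have h2 : HasMFDerivAt (𝓡∂ 4) 𝓘(ℝ, ℂ)
      (w g ∘ fun b : O => ((b : Base g).1 : EuclideanSpace ℝ (Fin 4))) a
      ((fderiv ℝ (w g) (a : Base g).1).comp
        ((ambientCLM g (a : Base g)).comp (ContinuousLinearMap.id ℝ (EuclideanSpace ℝ (Fin 4))))) :=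
    (hdw g (a : Base g).1).hasMFDerivAt.comp a (hasMFDerivAt_coe_coe a)
  have heq : (w g' ∘ (RegularSublevel.incl (isRegularLevel_rho g') ∘ Θ)) =ᶠ[𝓝 a]
      (w g ∘ fun b : O => ((b : Base g).1 : EuclideanSpace ℝ (Fin 4))) := by
    filter_upwards [hfib] with b hb
    exact hb
  have h3 := h2.congr_of_eventuallyEq heq
  have e := hasMFDerivAt_unique h1 h3
  have key : fderiv ℝ (w g') (Θ a).1 (ambient g' (Θ a) (mfderiv (𝓡∂ 4) (𝓡∂ 4) Θ a v)) =
      fderiv ℝ (w g) (a : Base g).1 (ambient g (a : Base g) v) :=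
    congrArg (fun L : EuclideanSpace ℝ (Fin 4) →L[ℝ] ℂ => L v) e
  rw [ambient_mfderiv_localRep hΘ hJ hΘJ v, ← hX, fderiv_w_apply, fderiv_w_apply] at key
  exact key

/-- **Velocity through a local ambient representative**: for a loop `K` in `O`, differentiable at
`e^{2πit}`, the ambient parametrisation of `Θ ∘ K` has derivative `dJ (K̇)` at `t`, `K̇` the ambient
velocity of `K`. [folklore] -/
theorem hasDerivAt_ambCurve_localRep {Θ : O → Base g'}
    {K : sphere (0 : EuclideanSpace ℝ (Fin 2)) 1 → Base g} (hKO : ∀ θ, K θ ∈ O) (hKc : Continuous K)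
    {t : ℝ} (hKd : MDifferentiableAt (𝓡 1) (𝓡∂ 4) K (circlePt t))
    {J : EuclideanSpace ℝ (Fin 4) → EuclideanSpace ℝ (Fin 4)}
    (hJ : DifferentiableAt ℝ J (K (circlePt t)).1)
    (hΘJ : ∀ᶠ b in 𝓝 (⟨K (circlePt t), hKO _⟩ : O), (Θ b).1 = J (b : Base g).1) :
    HasDerivAt (ambCurve g' fun θ => Θ ⟨K θ, hKO θ⟩)
      (fderiv ℝ J (K (circlePt t)).1 (deriv (ambCurve g K) t)) t := by
  have hKh : Continuous fun s : ℝ => (⟨K (circlePt s), hKO _⟩ : O) :=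
    (hKc.comp continuous_circlePt).subtype_mk _
  have hev : (ambCurve g' fun θ => Θ ⟨K θ, hKO θ⟩) =ᶠ[𝓝 t] (J ∘ ambCurve g K) := by
    have := hKh.continuousAt.eventually hΘJ
    filter_upwards [this] with s hs
    exact hs
  have hd : HasDerivAt (J ∘ ambCurve g K) (fderiv ℝ J (K (circlePt t)).1 (deriv (ambCurve g K) t)) t := by
    have h := hJ.hasFDerivAt.comp_hasDerivAt t (hasDerivAt_ambCurve (g := g) hKd)
    rw [deriv_ambCurve hKd]
    exact h
  exact hd.congr_of_eventuallyEq hev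

end LocalRep

/-! ## §3 The transport theorem -/

/-- **Transport of page twistings across genera by a fibred, page-orientation-preserving smooth map
given through local ambient representatives.**  `O ⊆ Base g` open, `Θ : O → Base g'` a smooth
embedding; `K : 𝕊¹ → Base g` a smooth embedding into `page g d` (`‖d‖ = 1`) with values in `O`, `ν` a
framing of `K` in `∂ Base g`; `Θ ∘ K ⊂ page g' d`; near every `K θ`, `Θ` preserves `w`
(`w_{g'} (Θ b) = w_g b`) and is the restriction of a `C¹` map `J` of `ℝ⁴` with
`0 < pageDet g (dJ_{K θ}) (K θ)`.  Then
`pageTwisting g' (Θ ∘ K) (dΘ ν) = pageTwisting g K ν`: the normal components of the two twisting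
loops differ by a positive factor (`inner_horizNormal_transport`, from `dΦ' ∘ dJ = dΦ`), and where they
vanish the in-page components differ by a positive factor (`pageDet > 0`), so
`wind_eq_of_pointwise_frame` applies with `s₀ = 1`. [cite: EtnyreFuller2006, §2] -/
theorem pageTwisting_localRep {O : TopologicalSpace.Opens (Base g)} {Θ : O → Base g'}
    (hΘ : Manifold.IsSmoothEmbedding (𝓡∂ 4) (𝓡∂ 4) ∞ Θ) {d : ℂ} (hd : ‖d‖ = 1)
    {K : sphere (0 : EuclideanSpace ℝ (Fin 2)) 1 → Base g}
    {ν : sphere (0 : EuclideanSpace ℝ (Fin 2)) 1 → EuclideanSpace ℝ (Fin 4)}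
    (hK : Manifold.IsSmoothEmbedding (𝓡 1) (𝓡∂ 4) ∞ K) (hKd : ∀ θ, K θ ∈ page g d)
    (hKO : ∀ θ, K θ ∈ O) (hν : IsKnotFraming K ν)
    (hΘd : ∀ θ, Θ ⟨K θ, hKO θ⟩ ∈ page g' d)
    (hfib : ∀ θ, ∀ᶠ b in 𝓝 (⟨K θ, hKO θ⟩ : O), w g' (Θ b).1 = w g (b : Base g).1)
    (hrep : ∀ θ, ∃ J : EuclideanSpace ℝ (Fin 4) → EuclideanSpace ℝ (Fin 4),
      ContDiffAt ℝ 1 J (K θ).1 ∧ (∀ᶠ b in 𝓝 (⟨K θ, hKO θ⟩ : O), (Θ b).1 = J (b : Base g).1) ∧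
        0 < pageDet g (fderiv ℝ J (K θ).1) (K θ).1) :
    pageTwisting g' (fun θ => Θ ⟨K θ, hKO θ⟩)
        (fun θ => mfderiv (𝓡∂ 4) (𝓡∂ 4) Θ ⟨K θ, hKO θ⟩ (ν θ)) =
      pageTwisting g K ν := by
  set K' : sphere (0 : EuclideanSpace ℝ (Fin 2)) 1 → Base g' := fun θ => Θ ⟨K θ, hKO θ⟩ with hK'
  set ν' : sphere (0 : EuclideanSpace ℝ (Fin 2)) 1 → EuclideanSpace ℝ (Fin 4) :=
    fun θ => mfderiv (𝓡∂ 4) (𝓡∂ 4) Θ ⟨K θ, hKO θ⟩ (ν θ) with hν'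
  set Kh : sphere (0 : EuclideanSpace ℝ (Fin 2)) 1 → O := fun θ => ⟨K θ, hKO θ⟩ with hKh
  -- smoothness of the players
  have hKc : Continuous K := hK.isEmbedding.continuous
  have hKhs : ContMDiff (𝓡 1) (𝓡∂ 4) ∞ Kh := (ContMDiff.subtypeVal_comp_iff O Kh).1 hK.contMDiff
  have hΘs : ContMDiff (𝓡∂ 4) (𝓡∂ 4) ∞ Θ := hΘ.contMDiff
  have hΘmd : ∀ a : O, MDifferentiableAt (𝓡∂ 4) (𝓡∂ 4) Θ a := fun a => hΘs.mdifferentiableAt (by simp)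
  have hK'1 : ContMDiff (𝓡 1) (𝓡∂ 4) 1 K' := (hΘs.comp hKhs).of_le (by simp)
  have hK1 : ContMDiff (𝓡 1) (𝓡∂ 4) 1 K := hK.contMDiff.of_le (by simp)
  have hKmd : ∀ θ, MDifferentiableAt (𝓡 1) (𝓡∂ 4) K θ := fun θ => hK.contMDiff.mdifferentiableAt (by simp)
  have hΘinj : ∀ a : O, Injective (mfderiv (𝓡∂ 4) (𝓡∂ 4) Θ a) := by
    obtain ⟨F, _, _, hF⟩ := hΘ.isImmersion
    exact fun a => Manifold.IsImmersionAtOfComplement.mfderiv_injective (hF a) (by simp)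
  -- the ambient framing vectors of `(K, ν)` depend continuously on `θ`
  have hV : Continuous fun θ => ambient g (K θ) (ν θ) := continuous_ambient.comp hν.continuous
  -- §2 at nearby parameters: the ambient framing vectors of `(K', ν')` through a representative
  have hrepr : ∀ θ₀, ∃ J : EuclideanSpace ℝ (Fin 4) → EuclideanSpace ℝ (Fin 4),
      ContDiffAt ℝ 1 J (K θ₀).1 ∧ 0 < pageDet g (fderiv ℝ J (K θ₀).1) (K θ₀).1 ∧
      ∀ᶠ θ in 𝓝 θ₀, DifferentiableAt ℝ J (K θ).1 ∧
        (∀ᶠ b in 𝓝 (Kh θ), (Θ b).1 = J (b : Base g).1) := by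
    intro θ₀
    obtain ⟨J, hJ, hΘJ, hdet⟩ := hrep θ₀
    refine ⟨J, hJ, hdet, ?_⟩
    have h1 : ∀ᶠ p in 𝓝 (K θ₀).1, DifferentiableAt ℝ J p := by
      filter_upwards [hJ.eventually (by simp)] with p hp
      exact hp.differentiableAt (by simp)
    have h1' : ∀ᶠ θ in 𝓝 θ₀, DifferentiableAt ℝ J (K θ).1 :=
      ((continuous_subtype_val.comp hKc).continuousAt (x := θ₀)).eventually h1
    have h2 : ∀ᶠ b in 𝓝 (Kh θ₀), ∀ᶠ c in 𝓝 b, (Θ c).1 = J (c : Base g).1 :=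
      eventually_eventually_nhds.2 hΘJ
    have h2' : ∀ᶠ θ in 𝓝 θ₀, ∀ᶠ c in 𝓝 (Kh θ), (Θ c).1 = J (c : Base g).1 :=
      (hKhs.continuous.continuousAt (x := θ₀)).eventually h2
    exact h1'.and h2'
  have hA' : Continuous fun θ => ambient g' (K' θ) (ν' θ) := by
    rw [continuous_iff_continuousAt]
    intro θ₀
    obtain ⟨J, hJ, -, hnear⟩ := hrepr θ₀
    have hev : (fun θ => ambient g' (K' θ) (ν' θ)) =ᶠ[𝓝 θ₀]
        fun θ => fderiv ℝ J (K θ).1 (ambient g (K θ) (ν θ)) := by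
      filter_upwards [hnear] with θ hθ
      exact ambient_mfderiv_localRep (hΘmd _) hθ.1 hθ.2 (ν θ)
    refine ContinuousAt.congr_of_eventuallyEq ?_ hev
    have hL : ContinuousAt (fun θ => fderiv ℝ J (K θ).1) θ₀ :=
      ContinuousAt.comp (f := fun θ => (K θ).1) (x := θ₀) (hJ.continuousAt_fderiv (by simp))
        ((continuous_subtype_val.comp hKc).continuousAt)
    exact hL.clm_apply hV.continuousAt
  -- the two twisting loops
  set ℓ : ℝ → ℂ := pageTwistingLoop g K ν with hℓ
  set ℓ' : ℝ → ℂ := pageTwistingLoop g' K' ν' with hℓ'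
  have hℓc : Continuous ℓ := continuous_pageTwistingLoop_of_ambient hK1 hV
  have hℓ'c : Continuous ℓ' := continuous_pageTwistingLoop_of_ambient hK'1 hA'
  have hℓ0 : ∀ t, ℓ t ≠ 0 := fun t => pageTwistingLoop_ne_zero_of_isKnotFraming hd hK hKd hν t
  -- §3 the pointwise frame relations
  have hP : ∀ t : ℝ, (∃ κ : ℝ, 0 < κ ∧ (ℓ' t).im = κ * (ℓ t).im) ∧
      ((ℓ t).im = 0 → ∃ b : ℝ, 0 < ((1 : ℤ) : ℝ) * b ∧ (ℓ' t).re = b * (ℓ t).re) := by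
    intro t
    set θt := circlePt t with hθt
    obtain ⟨J, hJ, hdet, hnear⟩ := hrepr θt
    obtain ⟨hJd, hΘJ⟩ := hnear.self_of_nhds
    set L : EuclideanSpace ℝ (Fin 4) →L[ℝ] EuclideanSpace ℝ (Fin 4) := fderiv ℝ J (K θt).1 with hL
    set q : EuclideanSpace ℝ (Fin 4) := (K θt).1 with hq
    set q' : EuclideanSpace ℝ (Fin 4) := (K' θt).1 with hq'
    set T := deriv (ambCurve g K) t with hT
    set V := ambient g (K θt) (ν θt) with hVd
    -- the transported velocity and framing vector are `L T`, `L V`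
    have eT : deriv (ambCurve g' K') t = L T :=
      (hasDerivAt_ambCurve_localRep (Θ := Θ) hKO hKc (hKmd θt) hJd hΘJ).deriv
    have eV : ambient g' (K' θt) (ν' θt) = L V := ambient_mfderiv_localRep (hΘmd _) hJd hΘJ (ν θt)
    have hℓ't : ℓ' t = ⟨inner ℝ (L V) (cplxJ (L T)), inner ℝ (L V) (horizNormal g' q')⟩ := by
      show pageTwistingLoop g' K' ν' t = _
      unfold pageTwistingLoop
      rw [eT, eV]
      rfl
    have hℓt : ℓ t = ⟨inner ℝ V (cplxJ T), inner ℝ V (horizNormal g q)⟩ := rfl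
    -- flatness, fibredness
    have hq0 : q ≠ 0 := coe_ne_zero (K θt)
    have hq'0 : q' ≠ 0 := coe_ne_zero (K' θt)
    have hflat : ‖cx q‖ ^ 2 < 4 := (hKd θt).1
    have hwq : w g q = d / 2 := (hKd θt).2
    have hw0 : w g q ≠ 0 := by
      rw [hwq]
      intro h0
      have : d = 0 := by linear_combination 2 * h0
      rw [this, norm_zero] at hd
      exact zero_ne_one hd
    have hw : w g' q' = w g q := by rw [hwq]; exact (hΘd θt).2
    have hdΦ : ∀ u, dPhiX g' q' * cx (L u) + dPhiY q' * cy (L u) = dPhiX g q * cx u + dPhiY q * cy u :=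
      fun u => dPhi_localRep_of_fibred (hΘmd _) hJd hΘJ (hfib θt) u
    -- tangency of `V` and `T`
    have hTd := hasDerivAt_ambCurve (g := g) (hKmd θt)
    have hTL : dPhiX g q * cx T + dPhiY q * cy T = 0 :=
      dPhi_velocity_eq_zero_of_page hKd hTd.differentiableAt.hasDerivAt
    have hT0 : T ≠ 0 := by
      rw [hT, hTd.deriv]
      intro h0
      exact knotVelocity_ne_zero hK t (injective_ambient _ (h0.trans (map_zero _).symm))
    have hν0 : ν θt 0 = 0 := (mem_boundaryTangentSpace_iff _).1 (hν.mem_boundaryTangentSpace θt)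
    have hbdry : rho g q = 1 / 4 := rho_eq_of_mem_page g hd (hKd θt)
    have hVρ : fderiv ℝ (rho g) q V = 0 := by
      rw [hVd, hq, fderiv_rho_ambient _ hbdry, hν0, neg_zero]
    have hVt : (conj (w g q) * (dPhiX g q * cx V + dPhiY q * cy V)).re = 0 := by
      rw [fderiv_rho_apply_of_flat hflat] at hVρ
      linarith
    refine ⟨⟨_, normFactor_pos (g := g) (g' := g') hq0 hq'0, ?_⟩, fun him => ?_⟩
    · rw [hℓ't, hℓt]
      exact inner_horizNormal_transport hq0 hq'0 L.toLinearMap hw hdΦ V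
    · -- the framing vector is a page tangent: `dΦ V = 0`
      have him' : inner ℝ V (horizNormal g q) = 0 := by rw [hℓt] at him; exact him
      have hVL : dPhiX g q * cx V + dPhiY q * cy V = 0 := by
        have hre : (conj (w g q) * (dPhiX g q * cx V + dPhiY q * cy V)).re = 0 := hVt
        have him2 : (conj (w g q) * (dPhiX g q * cx V + dPhiY q * cy V)).im = 0 := by
          rw [inner_horizNormal, div_eq_zero_iff] at him'
          exact him'.resolve_right (normSq_dPhi_ne_zero hq0)
        have hprod : conj (w g q) * (dPhiX g q * cx V + dPhiY q * cy V) = 0 :=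
          Complex.ext (by rw [hre, Complex.zero_re]) (by rw [him2, Complex.zero_im])
        exact (mul_eq_zero.1 hprod).resolve_left ((map_ne_zero _).2 hw0)
      have hrel := inner_cplxJ_map_of_mem_line L.toLinearMap hq0 hT0 hTL hVL
      obtain ⟨c₀, hc₀, hpd⟩ := inner_cplxJ_map_eq_mul_pageDet L hq0 hT0 hTL
      refine ⟨inner ℝ (L (cplxJ T)) (cplxJ (L T)) / ‖T‖ ^ 2, ?_, ?_⟩
      · have hT2 : (0 : ℝ) < ‖T‖ ^ 2 := by positivity
        rw [Int.cast_one, one_mul, hpd]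
        exact div_pos (mul_pos hc₀ hdet) hT2
      · rw [hℓ't, hℓt]
        exact hrel
  -- §4 the winding step
  have key := wind_eq_of_pointwise_frame (σ := 1) hℓc hℓ'c pageTwistingLoop_zero_eq_one
    pageTwistingLoop_zero_eq_one hℓ0 (Or.inl rfl) (fun t _ => (hP t).1) (fun t _ => (hP t).2)
  show Literature.Topology.PlaneTopology.wind ℓ' = Literature.Topology.PlaneTopology.wind ℓ
  rw [key, one_mul]

/-! ## §4 The clause `twisting_transport` of `StabBaseData` from local data of `E` -/

/-- **Clause `twisting_transport` of `StabBaseData g n c` for a 1-handle presentation `E` of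
`Base (g+1)` over `Base g`** — VERBATIM its text — from: `flat` (flat page points off the 1-handle
ranges go into the flat page of the same direction), fibredness on a NEIGHBOURHOOD of every point off the
1-handle ranges, and, at every flat page point off the ranges, a local `C¹` ambient representative of
`E.jA` with positive page determinant. [cite: EtnyreFuller2006, §2] -/
theorem twisting_transport_of_localRep {q1 : Fin 2 → HandleAttachingMap 3 1 (Base g)}
    (E : MultiAttachmentData q1 (𝓡∂ 4) (Base (g + 1)))
    (page_mem : ∀ (d : ℂ), ‖d‖ = 1 → ∀ p ∈ page g d, p ∈ coresComplement q1)
    (flat : ∀ (d : ℂ), ‖d‖ = 1 → ∀ (a : ↥(coresComplement q1)),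
      (∀ i y, (q1 i).toFun y ≠ (a : Base g)) → (a : Base g) ∈ page g d → E.jA a ∈ page (g + 1) d)
    (fibred_nhds : ∀ a : ↥(coresComplement q1), (∀ i y, (q1 i).toFun y ≠ (a : Base g)) →
      ∀ᶠ b in 𝓝 a, w (g + 1) (E.jA b).1 = w g (b : Base g).1)
    (localRep : ∀ (d : ℂ), ‖d‖ = 1 → ∀ a : ↥(coresComplement q1),
      (∀ i y, (q1 i).toFun y ≠ (a : Base g)) → (a : Base g) ∈ page g d →
      ∃ J : EuclideanSpace ℝ (Fin 4) → EuclideanSpace ℝ (Fin 4),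
        ContDiffAt ℝ 1 J (a : Base g).1 ∧ (∀ᶠ b in 𝓝 a, (E.jA b).1 = J (b : Base g).1) ∧
          0 < pageDet g (fderiv ℝ J (a : Base g).1) (a : Base g).1) :
    ∀ (d : ℂ) (hd : ‖d‖ = 1)
      (K : Metric.sphere (0 : EuclideanSpace ℝ (Fin 2)) 1 → Base g)
      (ν : Metric.sphere (0 : EuclideanSpace ℝ (Fin 2)) 1 → EuclideanSpace ℝ (Fin 4)),
      Manifold.IsSmoothEmbedding (𝓡 1) (𝓡∂ 4) ∞ K → (hKd : ∀ θ, K θ ∈ page g d) →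
      (∀ θ i y, (q1 i).toFun y ≠ K θ) → IsKnotFraming K ν →
      pageTwisting (g + 1) (fun θ => E.jA ⟨K θ, page_mem d hd (K θ) (hKd θ)⟩)
          (fun θ => mfderiv (𝓡∂ 4) (𝓡∂ 4) E.jA ⟨K θ, page_mem d hd (K θ) (hKd θ)⟩ (ν θ)) =
        pageTwisting g K ν := by
  intro d hd K ν hK hKd hoff hν
  refine pageTwisting_localRep E.hjA hd hK hKd (fun θ => page_mem d hd (K θ) (hKd θ)) hν
    (fun θ => flat d hd _ (hoff θ) (hKd θ)) (fun θ => fibred_nhds _ (hoff θ)) fun θ => ?_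
  exact localRep d hd ⟨K θ, page_mem d hd (K θ) (hKd θ)⟩ (hoff θ) (hKd θ)

end StabTwistTransport

/-! ## Registered helper -/

/-- **Registered helper `helper_pageTwisting_localRep` (sub-goal of `stub_STgeo` ▸ N3-nat ▸ N3d-1 ▸ G1d
`twisting_transport`, wave 8, lead c5): transport of page twistings across genera by a smooth embedding of an
open submanifold of `Base g` into `Base g'` that is fibred near a framed embedded page curve and is there the
restriction of `C¹` maps of `ℝ⁴` with positive page determinant.** [cite: EtnyreFuller2006, §2] -/
theorem helper_pageTwisting_localRep : ∀ (g g' : ℕ) (O : TopologicalSpace.Opens (Literature.Topology.FourManifolds.LefschetzBase.Base g)) (Θ : ↥O → Literature.Topology.FourManifolds.LefschetzBase.Base g'), Manifold.IsSmoothEmbedding (𝓡∂ 4) (𝓡∂ 4) ∞ Θ → ∀ (d : ℂ), ‖d‖ = 1 → ∀ (K : Metric.sphere (0 : EuclideanSpace ℝ (Fin 2)) 1 → Literature.Topology.FourManifolds.LefschetzBase.Base g) (ν : Metric.sphere (0 : EuclideanSpace ℝ (Fin 2)) 1 → EuclideanSpace ℝ (Fin 4)), Manifold.IsSmoothEmbedding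 (𝓡 1) (𝓡∂ 4) ∞ K → (∀ θ, K θ ∈ Literature.Topology.FourManifolds.LefschetzBase.page g d) → ∀ (hKO : ∀ θ, K θ ∈ O), Literature.Geometry.Symplectic.IsKnotFraming K ν → (∀ θ, Θ ⟨K θ, hKO θ⟩ ∈ Literature.Topology.FourManifolds.LefschetzBase.page g' d) → (∀ θ, ∀ᶠ b in nhds (⟨K θ, hKO θ⟩ : ↥O), Literature.Topology.FourManifolds.LefschetzBase.w g' (Θ b).1 = Literature.Topology.FourManifolds.LefschetzBase.w g (b : Literature.Topology.FourManifolds.LefschetzBase.Base g).1) → (∀ θ, ∃ J : EuclideanSpace ℝ (Fin 4) → EuclideanSpace ℝ (Fin 4), ContDiffAt ℝ 1 J (K θ).1 ∧ (∀ᶠ b in nhds (⟨K θ, hKO θ⟩ : ↥O), (Θ b).1 = J (b : Literature.Topology.FourManifolds.LefschetzBase.Base g).1) ∧ 0 < Summit.SmoothPoincare4.SmoothPoincare4.Theorems.AcyclicBisectionExists.ModpBraidOrbits.pageDet g (fderiv ℝ J (K θ).1) (K θ).1) → Literature.Topology.FourManifolds.LefschetzBase.pageTwisting g' (fun θ =>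 Θ ⟨K θ, hKO θ⟩) (fun θ => mfderiv (𝓡∂ 4) (𝓡∂ 4) Θ ⟨K θ, hKO θ⟩ (ν θ)) = Literature.Topology.FourManifolds.LefschetzBase.pageTwisting g K ν :=
  fun _ _ _ _ hΘ _ hd _ _ hK hKd hKO hν hΘd hfib hrep =>
    StabTwistTransport.pageTwisting_localRep hΘ hd hK hKd hKO hν hΘd hfib hrep

end Summit.SmoothPoincare4.SmoothPoincare4.Theorems.AcyclicBisectionExists.ModpBraidOrbits

end
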